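import Literature.NumberTheory.Transcendental.MasserThmIDerivation
import Literature.NumberTheory.Transcendental.AlgebraicGeneratorsField
import Literature.NumberTheory.Transcendental.SiegelWrapper
import Literature.NumberTheory.EllipticCurves.WeierstrassTorsion
import HarnessLib

/-!
# Masser 1975, Theorem I — the arithmetic half (Lemma 1.8: Siegel's lemma; Liouville steps)

Support for the proof of Theorem I (a transcendence measure for `τ = ω₂/ω₁`) of D. W. Masser,
*Elliptic Functions and Transcendence*, LNM 437 (1975), Ch. I §1.3, on the book's own line towards
Theorem II (`Literature.NumberTheory.Transcendental.masser_ellipticPeriods`).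

In Lemma 1.8 the coefficients `p(λ₁,λ₂)` are chosen (by Lemma 1.7 = Siegel's lemma over `ℤ`,
after Lemma 1.6 = an integral basis of `𝔽 = ℚ(g₂, g₃, α, ℘⁽ʲ⁾(¼ωᵢ))` of controlled size) so that
`A_m = ∑ p(λ₁,λ₂) Q(λ₁,λ₂,m) = 0` (`0 ≤ m ≤ k`),
`Q(λ₁,λ₂,m) = ∑_μ binom(m,μ) α^μ ℘(¼ω₁,λ₁,m-μ) ℘(¼ω₂,λ₂,μ)`. We follow the printed argument with
two organisational changes that use the tree's tools and keep every constant UNIFORM in the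
approximating algebraic number `α`:

* only the FIXED number field `K₀ = ℚ(g₂/2, ℘(ωᵢ/4), ℘'(ωᵢ/4))` (`TSetup.K`, an `AlgGens` field) is
  used; Theorem I is needed (for Theorem II, via Lemma 2.2) only for `α` of degree `≤ 2`, a root
  of `A + Bx + Cx²` (`QData`), and `α` enters through `β = Cα` (`β² + Bβ + AC = 0`) and the
  integers `t₀(r), t₁(r)` with `β^r = t₀(r) + t₁(r) β` (`tPair`, `beta_pow_eq`): the condition
  `A_m(α) = 0` is implied by the TWO `K₀`-linear conditions `E₀(m) = E₁(m) = 0`,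
  `C^m A_m(α) = E₀(m) + β E₁(m)` (`Cpow_mul_Aval_eq`), whose coefficients are the values of the
  integer polynomials `W ν m λ₁ λ₂` (`W`) at `a = (g₂/2, ℘(ωᵢ/4), ℘'(ωᵢ/4))`;
* Siegel's lemma is applied over `𝓞 K₀` (`siegel_house`, house form; `exists_solution`) in place of
  Lemmas 1.6–1.7, and Liouville's inequality is `AlgGens.norm_ge_of_forall_norm_le` in `K₀`, for
  numbers `x + βy` (`x, y ∈ 𝓞 K₀`) through the norm `x² - Bxy + ACy²` (`quad_liouville`).

Also here: the comparison `|A_m(τ) - A_m(α)| ≤ (∑|p|) D(n,m) |τ - α|` (eq. (10); `norm_Aval_sub_le`).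
Everything here is proved; no named facts.

## References

* D. W. Masser, *Elliptic Functions and Transcendence*, Lecture Notes in Math. 437, Springer 1975,
  Ch. I §1.2 Lemmas 1.6, 1.7 and §1.3 Lemma 1.8, eq. (10) (pp. 4–6). [Masser1975]
* A. Baker, *Transcendental Number Theory*, CUP 1975, Ch. 6 §4 (the pattern of
  `SchneiderPeriodsProofs.lean`, Part III). [Baker1975]
-/

noncomputable section

open Complex MvPolynomial NumberField Finset
open scoped PeriodPair

namespace Literature.NumberTheory.Transcendental.Masser1975

open Literature.NumberTheory.Transcendental.Chudnovsky (l1 wnorm wnorm_mul_le wnorm_nonneg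
  normRingSeminorm_int_apply norm_aeval_le_l1)

/-! ### Quadratic data: `β = Cα`, `β² + Bβ + AC = 0`, and the powers of `β` -/

/-- The integers `(t₀(r), t₁(r))` with `β^r = t₀(r) + t₁(r) β` when `β² + Bβ + AC = 0`:
`t(0) = (1, 0)`, `t(r+1) = (-AC t₁(r), t₀(r) - B t₁(r))`. [cite: Masser1975, §1.3 (proof of Lemma 1.8)] -/
def tPair (A B C : ℤ) : ℕ → ℤ × ℤ
  | 0 => (1, 0)
  | r + 1 => (-(A * C) * (tPair A B C r).2, (tPair A B C r).1 - B * (tPair A B C r).2)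

/-- `β^r = t₀(r) + t₁(r) β`. [folklore] -/
theorem beta_pow_eq {A B C : ℤ} {β : ℂ} (hβ : β ^ 2 + B * β + A * C = 0) (r : ℕ) :
    β ^ r = ((tPair A B C r).1 : ℂ) + ((tPair A B C r).2 : ℂ) * β := by
  induction r with
  | zero => simp [tPair]
  | succ r ih =>
    have hβ2 : β ^ 2 = -(B : ℂ) * β - A * C := by linear_combination hβ
    rw [pow_succ, ih, tPair]
    push_cast
    linear_combination ((tPair A B C r).2 : ℂ) * hβ2

/-- `|t₀(r)|, |t₁(r)| ≤ (2H²)^r` if `|A|, |B|, |C| ≤ H`, `H ≥ 1`. [folklore] -/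
theorem abs_tPair_le {A B C : ℤ} {H : ℕ} (hH : 1 ≤ H) (hA : |A| ≤ H) (hB : |B| ≤ H)
    (hC : |C| ≤ H) (r : ℕ) :
    |((tPair A B C r).1 : ℝ)| ≤ (2 * (H : ℝ) ^ 2) ^ r ∧
      |((tPair A B C r).2 : ℝ)| ≤ (2 * (H : ℝ) ^ 2) ^ r := by
  have hH' : (1 : ℝ) ≤ H := by exact_mod_cast hH
  have hA' : |(A : ℝ)| ≤ H := by exact_mod_cast hA
  have hB' : |(B : ℝ)| ≤ H := by exact_mod_cast hB
  have hC' : |(C : ℝ)| ≤ H := by exact_mod_cast hC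
  induction r with
  | zero => simp [tPair]
  | succ r ih =>
    obtain ⟨ih1, ih2⟩ := ih
    set X : ℝ := (2 * (H : ℝ) ^ 2) ^ r with hX
    have hX0 : 0 ≤ X := by positivity
    simp only [tPair, Int.cast_mul, Int.cast_neg, Int.cast_sub]
    constructor
    · rw [abs_mul, abs_neg, abs_mul, pow_succ]
      calc |(A : ℝ)| * |(C : ℝ)| * |((tPair A B C r).2 : ℝ)| ≤ H * H * X := by
            gcongr
        _ ≤ X * (2 * (H : ℝ) ^ 2) := by nlinarith
    · rw [pow_succ]
      calc |((tPair A B C r).1 : ℝ) - B * (tPair A B C r).2|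
          ≤ |((tPair A B C r).1 : ℝ)| + |(B : ℝ)| * |((tPair A B C r).2 : ℝ)| := by
            rw [← abs_mul]; exact abs_sub _ _
        _ ≤ X + H * X := by gcongr
        _ ≤ X * (2 * (H : ℝ) ^ 2) := by
            have h := mul_le_mul_of_nonneg_left (show (1 : ℝ) + H ≤ 2 * (H : ℝ) ^ 2 by nlinarith) hX0
            linarith

/-- The quadratic data of Theorem I (degree `≤ 2`): integers `A, B, C` of absolute value `≤ H`,
`C ≠ 0`, and a complex root `β` of `y² + By + AC` (so that `α = β/C` is a root of
`A + Bx + Cx²`). [cite: Masser1975, Thm I (d ≤ 2) and Lemma 2.2] -/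
structure QData where
  /-- the coefficients of the quadratic -/
  A : ℤ
  /-- the coefficients of the quadratic -/
  B : ℤ
  /-- the coefficients of the quadratic -/
  C : ℤ
  /-- the height bound -/
  H : ℕ
  one_le_H : 1 ≤ H
  hA : |A| ≤ H
  hB : |B| ≤ H
  hC : |C| ≤ H
  hC0 : C ≠ 0
  /-- `β = Cα` -/
  β : ℂ
  hβ : β ^ 2 + B * β + A * C = 0

namespace QData

variable (Q : QData)

/-- `α = β / C`. [folklore] -/
def α : ℂ := Q.β / Q.C

/-- `t_ν(r)` as a single function of `ν ∈ {0, 1}`. [folklore] -/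
def t (ν : Fin 2) (r : ℕ) : ℤ := ![(tPair Q.A Q.B Q.C r).1, (tPair Q.A Q.B Q.C r).2] ν

/-- `|t_ν(r)| ≤ (2H²)^r`. [folklore] -/
theorem abs_t_le (ν : Fin 2) (r : ℕ) : |(Q.t ν r : ℝ)| ≤ (2 * (Q.H : ℝ) ^ 2) ^ r := by
  have h := abs_tPair_le Q.one_le_H Q.hA Q.hB Q.hC r
  fin_cases ν
  · exact h.1
  · exact h.2

/-- `C^r α^r = β^r = t₀(r) + t₁(r) β`. [folklore] -/
theorem Cpow_mul_αpow (r : ℕ) :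
    (Q.C : ℂ) ^ r * Q.α ^ r = (Q.t 0 r : ℂ) + (Q.t 1 r : ℂ) * Q.β := by
  have hC : (Q.C : ℂ) ≠ 0 := by exact_mod_cast Q.hC0
  rw [← mul_pow, α, mul_div_cancel₀ _ hC, beta_pow_eq Q.hβ r]
  rfl

/-- `|β| ≤ 2H`. [folklore] -/
theorem norm_β_le : ‖Q.β‖ ≤ 2 * Q.H := by
  by_contra hlt
  push Not at hlt
  have hH : (1 : ℝ) ≤ Q.H := by exact_mod_cast Q.one_le_H
  have hβ2 : Q.β ^ 2 = -((Q.B : ℂ) * Q.β + Q.A * Q.C) := by linear_combination Q.hβ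
  have h1 : ‖Q.β‖ ^ 2 ≤ Q.H * ‖Q.β‖ + Q.H * Q.H := by
    calc ‖Q.β‖ ^ 2 = ‖Q.β ^ 2‖ := (norm_pow _ 2).symm
      _ = ‖(Q.B : ℂ) * Q.β + Q.A * Q.C‖ := by rw [hβ2, norm_neg]
      _ ≤ ‖(Q.B : ℂ) * Q.β‖ + ‖(Q.A : ℂ) * Q.C‖ := norm_add_le _ _
      _ = |(Q.B : ℝ)| * ‖Q.β‖ + |(Q.A : ℝ)| * |(Q.C : ℝ)| := by
          rw [norm_mul, norm_mul, Complex.norm_intCast, Complex.norm_intCast, Complex.norm_intCast]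
      _ ≤ Q.H * ‖Q.β‖ + Q.H * Q.H := by
          have hA : |(Q.A : ℝ)| ≤ Q.H := by exact_mod_cast Q.hA
          have hB : |(Q.B : ℝ)| ≤ Q.H := by exact_mod_cast Q.hB
          have hC : |(Q.C : ℝ)| ≤ Q.H := by exact_mod_cast Q.hC
          gcongr
  nlinarith [norm_nonneg Q.β]

/-- The other root `β' = -B - β` of `y² + By + AC`: `|β'| ≤ 3H`. [folklore] -/
theorem norm_β'_le : ‖-(Q.B : ℂ) - Q.β‖ ≤ 3 * Q.H := by
  have hB : |(Q.B : ℝ)| ≤ Q.H := by exact_mod_cast Q.hB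
  calc ‖-(Q.B : ℂ) - Q.β‖ ≤ ‖-(Q.B : ℂ)‖ + ‖Q.β‖ := norm_sub_le _ _
    _ ≤ Q.H + 2 * Q.H := by
        rw [norm_neg, Complex.norm_intCast]
        exact add_le_add hB Q.norm_β_le
    _ = 3 * Q.H := by ring

/-- `|β - β'| ≥ 1` when the discriminant `B² - 4AC` is non-zero (`(β - β')² = B² - 4AC` is a
non-zero integer). [folklore] -/
theorem one_le_norm_β_sub_β' (hdisc : Q.B ^ 2 - 4 * Q.A * Q.C ≠ 0) :
    1 ≤ ‖Q.β - (-(Q.B : ℂ) - Q.β)‖ := by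
  have hsq : (Q.β - (-(Q.B : ℂ) - Q.β)) ^ 2 = ((Q.B ^ 2 - 4 * Q.A * Q.C : ℤ) : ℂ) := by
    push_cast
    linear_combination (4 : ℂ) * Q.hβ
  have h1 : (1 : ℝ) ≤ ‖(Q.β - (-(Q.B : ℂ) - Q.β)) ^ 2‖ := by
    rw [hsq, Complex.norm_intCast]
    exact_mod_cast Int.one_le_abs hdisc
  rw [norm_pow] at h1
  nlinarith [norm_nonneg (Q.β - (-(Q.B : ℂ) - Q.β))]

/-- **Liouville in `ℤ + ℤβ`**: for integers `u, v` with `u + vβ ≠ 0` (discriminant `≠ 0`),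
`|u + vβ| ≥ (|u| + 3H|v| + 1)⁻¹` (the norm `(u+vβ)(u+vβ') = u² - Buv + ACv²` is a non-zero integer,
or `u + vβ' = 0` and `|u + vβ| = |v||β - β'| ≥ 1`). [cite: Masser1975, §1.3 (end of the proof of Thm I, "|σ| > (LH)^{-c₂₈}")] -/
theorem norm_int_add_int_mul_β_ge (hdisc : Q.B ^ 2 - 4 * Q.A * Q.C ≠ 0) (u v : ℤ)
    (h : (u : ℂ) + (v : ℂ) * Q.β ≠ 0) :
    (|(u : ℝ)| + 3 * Q.H * |(v : ℝ)| + 1)⁻¹ ≤ ‖(u : ℂ) + (v : ℂ) * Q.β‖ := by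
  set β' : ℂ := -(Q.B : ℂ) - Q.β with hβ'
  have hden0 : 0 < |(u : ℝ)| + 3 * Q.H * |(v : ℝ)| + 1 := by positivity
  have hNint : ((u : ℂ) + (v : ℂ) * Q.β) * ((u : ℂ) + (v : ℂ) * β') =
      ((u ^ 2 - Q.B * u * v + Q.A * Q.C * v ^ 2 : ℤ) : ℂ) := by
    rw [hβ']; push_cast
    have hβ2 : Q.β ^ 2 = -(Q.B : ℂ) * Q.β - Q.A * Q.C := by linear_combination Q.hβ
    linear_combination (-(v : ℂ) ^ 2) * hβ2
  by_cases hcase : (u : ℂ) + (v : ℂ) * β' = 0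
  · -- `u + vβ = v (β - β')`, `v ≠ 0`
    have hv : v ≠ 0 := by
      intro hv0
      apply h
      have : (u : ℂ) = 0 := by simpa [hv0] using hcase
      simp [this, hv0]
    have heq : (u : ℂ) + (v : ℂ) * Q.β = (v : ℂ) * (Q.β - β') := by linear_combination hcase
    rw [heq, norm_mul, Complex.norm_intCast]
    have h1 := Q.one_le_norm_β_sub_β' hdisc
    have hv1 : (1 : ℝ) ≤ |(v : ℝ)| := by exact_mod_cast Int.one_le_abs hv
    have h0 : 0 ≤ |(u : ℝ)| + 3 * Q.H * |(v : ℝ)| := by positivity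
    calc (|(u : ℝ)| + 3 * Q.H * |(v : ℝ)| + 1)⁻¹ ≤ 1 := inv_le_one_of_one_le₀ (by linarith)
      _ ≤ |(v : ℝ)| * ‖Q.β - β'‖ := one_le_mul_of_one_le_of_one_le hv1 h1
  · -- the norm is a non-zero integer
    have hN0 : (u ^ 2 - Q.B * u * v + Q.A * Q.C * v ^ 2 : ℤ) ≠ 0 := by
      intro h0
      have : ((u : ℂ) + (v : ℂ) * Q.β) * ((u : ℂ) + (v : ℂ) * β') = 0 := by
        rw [hNint, h0]; simp
      rcases mul_eq_zero.mp this with h' | h'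
      · exact h h'
      · exact hcase h'
    have hN1 : (1 : ℝ) ≤ ‖((u : ℂ) + (v : ℂ) * Q.β) * ((u : ℂ) + (v : ℂ) * β')‖ := by
      rw [hNint, Complex.norm_intCast]
      exact_mod_cast Int.one_le_abs hN0
    rw [norm_mul] at hN1
    have hden : ‖(u : ℂ) + (v : ℂ) * β'‖ ≤ |(u : ℝ)| + 3 * Q.H * |(v : ℝ)| + 1 := by
      have hβ'le : ‖β'‖ ≤ 3 * Q.H := Q.norm_β'_le
      have hv0 : 0 ≤ |(v : ℝ)| := abs_nonneg _
      calc ‖(u : ℂ) + (v : ℂ) * β'‖ ≤ ‖(u : ℂ)‖ + ‖(v : ℂ)‖ * ‖β'‖ := by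
            rw [← norm_mul]; exact norm_add_le _ _
        _ ≤ |(u : ℝ)| + |(v : ℝ)| * (3 * Q.H) := by
            rw [Complex.norm_intCast, Complex.norm_intCast]
            gcongr
        _ ≤ |(u : ℝ)| + 3 * Q.H * |(v : ℝ)| + 1 := by linarith
    rw [inv_le_iff_one_le_mul₀ hden0]
    calc (1 : ℝ) ≤ ‖(u : ℂ) + (v : ℂ) * Q.β‖ * ‖(u : ℂ) + (v : ℂ) * β'‖ := hN1
      _ ≤ ‖(u : ℂ) + (v : ℂ) * Q.β‖ * (|(u : ℝ)| + 3 * Q.H * |(v : ℝ)| + 1) :=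
          mul_le_mul_of_nonneg_left hden (norm_nonneg _)

/-- **Lower bound for a non-vanishing quadratic form at `α`**: if `|A'|, |B'|, |C'| ≤ X` (`X ≥ 1`)
and `σ = A' + B'α + C'α² ≠ 0`, then `|σ| ≥ (9 X H⁴)⁻¹` (`C²σ = u + vβ` with integers
`u = A'C² - C'AC`, `v = B'C - C'B`). [cite: Masser1975, §1.3 (end of the proof of Thm I, "|σ| > (LH)^{-c₂₈}")] -/
theorem norm_quadForm_α_ge (hdisc : Q.B ^ 2 - 4 * Q.A * Q.C ≠ 0) {A' B' C' : ℤ} {X : ℕ}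
    (hX : 1 ≤ X) (hA' : |A'| ≤ X) (hB' : |B'| ≤ X) (hC' : |C'| ≤ X)
    (hne : (A' : ℂ) + (B' : ℂ) * Q.α + (C' : ℂ) * Q.α ^ 2 ≠ 0) :
    (9 * (X : ℝ) * (Q.H : ℝ) ^ 4)⁻¹ ≤ ‖(A' : ℂ) + (B' : ℂ) * Q.α + (C' : ℂ) * Q.α ^ 2‖ := by
  have hC : (Q.C : ℂ) ≠ 0 := by exact_mod_cast Q.hC0
  have hH : (1 : ℝ) ≤ Q.H := by exact_mod_cast Q.one_le_H
  have hX' : (1 : ℝ) ≤ X := by exact_mod_cast hX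
  set σ : ℂ := (A' : ℂ) + (B' : ℂ) * Q.α + (C' : ℂ) * Q.α ^ 2 with hσ
  set u : ℤ := A' * Q.C ^ 2 - C' * Q.A * Q.C with hu
  set v : ℤ := B' * Q.C - C' * Q.B with hv
  have hβ2 : Q.β ^ 2 = -(Q.B : ℂ) * Q.β - Q.A * Q.C := by linear_combination Q.hβ
  have hkey : (Q.C : ℂ) ^ 2 * σ = (u : ℂ) + (v : ℂ) * Q.β := by
    rw [hσ, hu, hv, QData.α]
    field_simp
    push_cast
    linear_combination (C' : ℂ) * hβ2
  have huv0 : (u : ℂ) + (v : ℂ) * Q.β ≠ 0 := by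
    rw [← hkey]; exact mul_ne_zero (pow_ne_zero _ hC) hne
  have hlow := Q.norm_int_add_int_mul_β_ge hdisc u v huv0
  -- sizes of `u, v`
  have hA : |(Q.A : ℝ)| ≤ Q.H := by exact_mod_cast Q.hA
  have hB : |(Q.B : ℝ)| ≤ Q.H := by exact_mod_cast Q.hB
  have hCH : |(Q.C : ℝ)| ≤ Q.H := by exact_mod_cast Q.hC
  have hA'r : |(A' : ℝ)| ≤ X := by exact_mod_cast hA'
  have hB'r : |(B' : ℝ)| ≤ X := by exact_mod_cast hB'
  have hC'r : |(C' : ℝ)| ≤ X := by exact_mod_cast hC'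
  have hule : |(u : ℝ)| ≤ 2 * X * (Q.H : ℝ) ^ 2 := by
    rw [hu]; push_cast
    calc |(A' : ℝ) * (Q.C : ℝ) ^ 2 - C' * Q.A * Q.C| ≤ |(A' : ℝ) * (Q.C : ℝ) ^ 2| + |(C' : ℝ) * Q.A * Q.C| :=
          abs_sub _ _
      _ = |(A' : ℝ)| * |(Q.C : ℝ)| ^ 2 + |(C' : ℝ)| * |(Q.A : ℝ)| * |(Q.C : ℝ)| := by
          rw [abs_mul, abs_mul, abs_mul, abs_pow]
      _ ≤ X * (Q.H : ℝ) ^ 2 + X * Q.H * Q.H := by gcongr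
      _ = 2 * X * (Q.H : ℝ) ^ 2 := by ring
  have hvle : |(v : ℝ)| ≤ 2 * X * Q.H := by
    rw [hv]; push_cast
    calc |(B' : ℝ) * Q.C - C' * Q.B| ≤ |(B' : ℝ) * Q.C| + |(C' : ℝ) * Q.B| := abs_sub _ _
      _ = |(B' : ℝ)| * |(Q.C : ℝ)| + |(C' : ℝ)| * |(Q.B : ℝ)| := by rw [abs_mul, abs_mul]
      _ ≤ X * Q.H + X * Q.H := by gcongr
      _ = 2 * X * Q.H := by ring
  have hden : |(u : ℝ)| + 3 * Q.H * |(v : ℝ)| + 1 ≤ 9 * X * (Q.H : ℝ) ^ 2 := by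
    have h1 : (1 : ℝ) ≤ X * (Q.H : ℝ) ^ 2 := one_le_mul_of_one_le_of_one_le hX' (one_le_pow₀ hH)
    nlinarith
  -- `‖σ‖ = ‖u + vβ‖ / C²`
  have hnormσ : ‖σ‖ = ‖(u : ℂ) + (v : ℂ) * Q.β‖ / ‖(Q.C : ℂ) ^ 2‖ := by
    rw [← hkey, norm_mul, mul_div_cancel_left₀ _ (norm_ne_zero_iff.mpr (pow_ne_zero _ hC))]
  rw [hnormσ, norm_pow, Complex.norm_intCast]
  have hC2 : 0 < |(Q.C : ℝ)| ^ 2 := by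
    have : (Q.C : ℝ) ≠ 0 := by exact_mod_cast Q.hC0
    positivity
  rw [le_div_iff₀ hC2]
  calc (9 * (X : ℝ) * (Q.H : ℝ) ^ 4)⁻¹ * |(Q.C : ℝ)| ^ 2 ≤ (9 * (X : ℝ) * (Q.H : ℝ) ^ 4)⁻¹ * (Q.H : ℝ) ^ 2 := by
        gcongr
    _ = (9 * (X : ℝ) * (Q.H : ℝ) ^ 2)⁻¹ := by
        have hH0 : (Q.H : ℝ) ≠ 0 := by positivity
        field_simp
    _ ≤ (|(u : ℝ)| + 3 * Q.H * |(v : ℝ)| + 1)⁻¹ := inv_anti₀ (by positivity) hden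
    _ ≤ ‖(u : ℂ) + (v : ℂ) * Q.β‖ := hlow

end QData

/-! ### The lattice data and the fixed number field `K₀` -/

/-- The data of Theorem I: a lattice with algebraic invariants (no assumption on `α` here).
[cite: Masser1975, Thm I] -/
structure TSetup : Type where
  /-- the lattice -/
  L : PeriodPair
  /-- `g₂` algebraic -/
  hg₂ : IsAlgebraic ℚ L.g₂
  /-- `g₃` algebraic -/
  hg₃ : IsAlgebraic ℚ L.g₃

namespace TSetup

variable (S : TSetup)

/-- `ωᵢ/4` is a torsion point of exact order dividing `4`, not in `Λ`. [folklore] -/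
theorem four_mul_div_four_mem (i : Fin 2) : (4 : ℂ) * (S.L.basis i / 4) ∈ S.L.lattice := by
  rw [mul_div_cancel₀ _ (by norm_num : (4 : ℂ) ≠ 0)]
  fin_cases i
  · simpa using S.L.ω₁_mem_lattice
  · simpa using S.L.ω₂_mem_lattice

/-- The five numbers `a = (g₂/2, ℘(ω₁/4), ℘'(ω₁/4), ℘(ω₂/4), ℘'(ω₂/4))` are algebraic (division
values of `℘`). [cite: Masser1975, §1.3 (proof of Lemma 1.8, "algebraic numbers ℘(¼ωᵢ,λᵢ,μᵢ)")] -/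
theorem isAlgebraic_xv (t : Fin 5) : IsAlgebraic ℚ (xv S.L t) := by
  have h℘ : ∀ i : Fin 2, IsAlgebraic ℚ (℘[S.L] (S.L.basis i / 4)) := fun i =>
    S.L.isAlgebraic_weierstrassP_of_torsion S.hg₂ S.hg₃ (basis_div_four_notMem S.L i)
      (m := 4) (by norm_num) (by exact_mod_cast S.four_mul_div_four_mem i)
  have h℘' : ∀ i : Fin 2, IsAlgebraic ℚ (℘'[S.L] (S.L.basis i / 4)) := fun i =>
    S.L.isAlgebraic_derivWeierstrassP_of_torsion S.hg₂ S.hg₃ (basis_div_four_notMem S.L i)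
      (m := 4) (by norm_num) (by exact_mod_cast S.four_mul_div_four_mem i)
  fin_cases t
  · change IsAlgebraic ℚ (S.L.g₂ / 2)
    rw [div_eq_mul_inv]
    exact S.hg₂.mul (by simpa using isAlgebraic_algebraMap (R := ℚ) (A := ℂ) (2⁻¹ : ℚ))
  · change IsAlgebraic ℚ (℘[S.L] (S.L.ω₁ / 4))
    simpa using h℘ 0
  · change IsAlgebraic ℚ (℘'[S.L] (S.L.ω₁ / 4))
    simpa using h℘' 0
  · change IsAlgebraic ℚ (℘[S.L] (S.L.ω₂ / 4))
    simpa using h℘ 1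
  · change IsAlgebraic ℚ (℘'[S.L] (S.L.ω₂ / 4))
    simpa using h℘' 1

/-- The algebraic data `a` of the proof (reducible: `G.ι = Fin 5` definitionally). [folklore] -/
abbrev G : AlgGens := ⟨Fin 5, xv S.L, S.isAlgebraic_xv⟩

/-- The FIXED number field `K₀ = ℚ(g₂/2, ℘(ωᵢ/4), ℘'(ωᵢ/4)) ⊆ ℂ` (Masser's `𝔽` without `α`).
[cite: Masser1975, §1.3 (proof of Lemma 1.8, the field 𝔽)] -/
abbrev K : IntermediateField ℚ ℂ := S.G.K

/-- The common denominator `d ≠ 0`. [folklore] -/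
abbrev d : ℤ := S.G.den

/-- The size constant `C₀ = |d| M ≥ 1`. [folklore] -/
def C₀ : ℝ := |(S.d : ℝ)| * S.G.M

/-- `1 ≤ C₀`. [folklore] -/
theorem one_le_C₀ : 1 ≤ S.C₀ := one_le_mul_of_one_le_of_one_le S.G.one_le_abs_den S.G.one_le_M

/-- The inclusion `K ⊆ ℂ` applied to `P(genK)` is `P(a) = φx P`. [folklore] -/
theorem coe_aeval_genK (P : MvPolynomial (Fin 5) ℤ) :
    ((MvPolynomial.aeval S.G.genK P : S.K) : ℂ) = φx S.L P :=
  (MvPolynomial.aeval_algebraMap_apply (R := ℤ) (B := ℂ) S.G.genK P).symm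

/-- `ℓ¹`-norm versus the coefficient sum of `AlgGens.norm_embedding_aeval_le`. [folklore] -/
theorem sum_abs_coeff_eq_l1 (P : MvPolynomial (Fin 5) ℤ) :
    (∑ a ∈ P.support, |((P.coeff a : ℤ) : ℝ)|) = l1 P := by
  unfold l1 Chudnovsky.wnorm
  simp only [Chudnovsky.normRingSeminorm_int_apply]

/-- The generators are bounded by `M`: `‖a_t‖ ≤ M`. [folklore] -/
theorem norm_xv_le (t : Fin 5) : ‖xv S.L t‖ ≤ S.G.M := by
  have h := S.G.norm_embedding_genK_le (algebraMap S.K ℂ) t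
  simpa using h

end TSetup

/-! ### The integer polynomials `W ν m λ₁ λ₂` -/

variable (Q : QData)

/-- `W ν m λ₁ λ₂ = ∑_μ binom(m,μ) C^μ t_ν(m-μ) · U₁(λ₁, μ) U₂(λ₂, m-μ) ∈ ℤ[a]`: the coefficients of
the two `K₀`-linear conditions `E_ν(m) = ∑ p(λ₁,λ₂) W ν m λ₁ λ₂ (a) = 0` replacing `A_m = 0`.
[cite: Masser1975, §1.3 (proof of Lemma 1.8, Q(λ₁,λ₂,m))] -/
def W (ν : Fin 2) (m i j : ℕ) : MvPolynomial (Fin 5) ℤ :=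
  ∑ μ ∈ Finset.range (m + 1), ((m.choose μ : ℤ) * Q.C ^ μ * Q.t ν (m - μ)) • (U₁ i μ * U₂ j (m - μ))

/-- **Degree bound** `deg W ≤ λ₁ + λ₂ + m`. [folklore] -/
theorem totalDegree_W_le (ν : Fin 2) (m i j : ℕ) : (W Q ν m i j).totalDegree ≤ i + j + m := by
  unfold W
  refine (totalDegree_finsetSum _ _).trans (Finset.sup_le fun μ hμ => ?_)
  have hμ : μ ≤ m := Nat.lt_succ_iff.mp (Finset.mem_range.mp hμ)
  refine (totalDegree_smul_le _ _).trans ((totalDegree_mul _ _).trans ?_)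
  have h1 := totalDegree_U₁_le i μ
  have h2 := totalDegree_U₂_le j (m - μ)
  omega

/-- **Height bound** `l1 W ≤ (4H³)^m (7(λ₁+λ₂+m))^{2m}`. [folklore] -/
theorem l1_W_le (ν : Fin 2) (m i j : ℕ) :
    l1 (W Q ν m i j) ≤ (4 * (Q.H : ℝ) ^ 3) ^ m * (7 * ((i : ℝ) + j + m)) ^ (2 * m) := by
  have hH : (1 : ℝ) ≤ Q.H := by exact_mod_cast Q.one_le_H
  set N : ℝ := 7 * ((i : ℝ) + j + m) with hN
  have hN0 : 0 ≤ N := by positivity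
  -- each summand
  have hterm : ∀ μ ∈ Finset.range (m + 1),
      l1 (((m.choose μ : ℤ) * Q.C ^ μ * Q.t ν (m - μ)) • (U₁ i μ * U₂ j (m - μ))) ≤
        (m.choose μ : ℝ) * ((Q.H : ℝ) ^ μ * (2 * (Q.H : ℝ) ^ 2) ^ (m - μ)) * N ^ (2 * m) := by
    intro μ hμ
    have hμ : μ ≤ m := Nat.lt_succ_iff.mp (Finset.mem_range.mp hμ)
    refine (Chudnovsky.l1_zsmul_le _ _).trans ?_
    have hcoef : |(((m.choose μ : ℤ) * Q.C ^ μ * Q.t ν (m - μ) : ℤ) : ℝ)| ≤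
        (m.choose μ : ℝ) * ((Q.H : ℝ) ^ μ * (2 * (Q.H : ℝ) ^ 2) ^ (m - μ)) := by
      push_cast
      rw [abs_mul, abs_mul, Nat.abs_cast, abs_pow]
      have hC : |(Q.C : ℝ)| ≤ Q.H := by exact_mod_cast Q.hC
      have ht := Q.abs_t_le ν (m - μ)
      have h1 : |(Q.C : ℝ)| ^ μ ≤ (Q.H : ℝ) ^ μ := pow_le_pow_left₀ (abs_nonneg _) hC μ
      calc (m.choose μ : ℝ) * |(Q.C : ℝ)| ^ μ * |(Q.t ν (m - μ) : ℝ)|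
          ≤ (m.choose μ : ℝ) * (Q.H : ℝ) ^ μ * (2 * (Q.H : ℝ) ^ 2) ^ (m - μ) := by gcongr
        _ = (m.choose μ : ℝ) * ((Q.H : ℝ) ^ μ * (2 * (Q.H : ℝ) ^ 2) ^ (m - μ)) := by ring
    have hprod : l1 (U₁ i μ * U₂ j (m - μ)) ≤ N ^ (2 * m) := by
      refine (wnorm_mul_le _ _ _).trans ?_
      have h1 : l1 (U₁ i μ) ≤ N ^ m := by
        refine (l1_U₁_le i μ).trans ?_
        calc (7 * ((i : ℝ) + μ)) ^ μ ≤ N ^ μ := by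
              refine pow_le_pow_left₀ (by positivity) ?_ _
              rw [hN]; have : (μ : ℝ) ≤ m := by exact_mod_cast hμ
              nlinarith
          _ ≤ N ^ m := by
              rcases Nat.eq_zero_or_pos μ with h0 | hpos
              · subst h0
                simp only [pow_zero]
                rcases Nat.eq_zero_or_pos m with hm0 | hmpos
                · subst hm0; simp
                · have hN1 : 1 ≤ N := by
                    rw [hN]; have : (1 : ℝ) ≤ m := by exact_mod_cast hmpos
                    nlinarith
                  exact one_le_pow₀ hN1
              · have hN1 : 1 ≤ N := by
                  rw [hN]; have : (1 : ℝ) ≤ μ := by exact_mod_cast hpos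
                  have : (μ : ℝ) ≤ m := by exact_mod_cast hμ
                  nlinarith
                exact pow_le_pow_right₀ hN1 hμ
      have h2 : l1 (U₂ j (m - μ)) ≤ N ^ m := by
        refine (l1_U₂_le j (m - μ)).trans ?_
        have hmμ : ((m - μ : ℕ) : ℝ) ≤ m := by exact_mod_cast Nat.sub_le m μ
        calc (7 * ((j : ℝ) + ((m - μ : ℕ) : ℝ))) ^ (m - μ) ≤ N ^ (m - μ) := by
              refine pow_le_pow_left₀ (by positivity) ?_ _
              rw [hN]; nlinarith
          _ ≤ N ^ m := by
              rcases Nat.eq_zero_or_pos (m - μ) with h0 | hpos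
              · rw [h0, pow_zero]
                rcases Nat.eq_zero_or_pos m with hm0 | hmpos
                · subst hm0; simp
                · have hN1 : 1 ≤ N := by
                    rw [hN]; have : (1 : ℝ) ≤ m := by exact_mod_cast hmpos
                    nlinarith
                  exact one_le_pow₀ hN1
              · have hN1 : 1 ≤ N := by
                  rw [hN]; have : (1 : ℝ) ≤ ((m - μ : ℕ) : ℝ) := by exact_mod_cast hpos
                  nlinarith
                exact pow_le_pow_right₀ hN1 (Nat.sub_le m μ)
      have h0 : 0 ≤ l1 (U₂ j (m - μ)) := wnorm_nonneg _ _
      calc l1 (U₁ i μ) * l1 (U₂ j (m - μ)) ≤ N ^ m * N ^ m :=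
            mul_le_mul h1 h2 h0 (by positivity)
        _ = N ^ (2 * m) := by rw [← pow_add]; ring_nf
    calc |(((m.choose μ : ℤ) * Q.C ^ μ * Q.t ν (m - μ) : ℤ) : ℝ)| * l1 (U₁ i μ * U₂ j (m - μ))
        ≤ ((m.choose μ : ℝ) * ((Q.H : ℝ) ^ μ * (2 * (Q.H : ℝ) ^ 2) ^ (m - μ))) * N ^ (2 * m) :=
          mul_le_mul hcoef hprod (wnorm_nonneg _ _) (by positivity)
      _ = _ := by ring
  -- sum over `μ`: `∑ binom(m,μ) H^μ (2H²)^{m-μ} = (H + 2H²)^m ≤ (4H³)^m`... we use the cruder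
  -- termwise bound `H^μ (2H²)^{m-μ} ≤ (2H²)^m ≤ (2H³)^m` and `∑ binom = 2^m`.
  have hsum : ∑ μ ∈ Finset.range (m + 1), (m.choose μ : ℝ) * ((Q.H : ℝ) ^ μ * (2 * (Q.H : ℝ) ^ 2) ^ (m - μ))
      ≤ (4 * (Q.H : ℝ) ^ 3) ^ m := by
    have hle : ∀ μ ∈ Finset.range (m + 1), (m.choose μ : ℝ) * ((Q.H : ℝ) ^ μ * (2 * (Q.H : ℝ) ^ 2) ^ (m - μ))
        ≤ (m.choose μ : ℝ) * (2 * (Q.H : ℝ) ^ 3) ^ m := by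
      intro μ hμ
      have hμ : μ ≤ m := Nat.lt_succ_iff.mp (Finset.mem_range.mp hμ)
      refine mul_le_mul_of_nonneg_left ?_ (by positivity)
      have h2H : (1 : ℝ) ≤ 2 * (Q.H : ℝ) ^ 2 := by nlinarith
      have h2H3 : 2 * (Q.H : ℝ) ^ 2 ≤ 2 * (Q.H : ℝ) ^ 3 := by nlinarith
      calc (Q.H : ℝ) ^ μ * (2 * (Q.H : ℝ) ^ 2) ^ (m - μ)
          ≤ (2 * (Q.H : ℝ) ^ 3) ^ μ * (2 * (Q.H : ℝ) ^ 3) ^ (m - μ) := by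
            refine mul_le_mul (pow_le_pow_left₀ (by positivity) (by nlinarith) _)
              (pow_le_pow_left₀ (by positivity) h2H3 _) (by positivity) (by positivity)
        _ = (2 * (Q.H : ℝ) ^ 3) ^ m := by rw [← pow_add]; congr 1; omega
    calc ∑ μ ∈ Finset.range (m + 1), (m.choose μ : ℝ) * ((Q.H : ℝ) ^ μ * (2 * (Q.H : ℝ) ^ 2) ^ (m - μ))
        ≤ ∑ μ ∈ Finset.range (m + 1), (m.choose μ : ℝ) * (2 * (Q.H : ℝ) ^ 3) ^ m :=
          Finset.sum_le_sum hle
      _ = (2 : ℝ) ^ m * (2 * (Q.H : ℝ) ^ 3) ^ m := by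
          rw [← Finset.sum_mul]
          congr 1
          have := (Nat.sum_range_choose m)
          exact_mod_cast this
      _ = (4 * (Q.H : ℝ) ^ 3) ^ m := by rw [← mul_pow]; ring_nf
  calc l1 (W Q ν m i j) ≤ ∑ μ ∈ Finset.range (m + 1),
        l1 (((m.choose μ : ℤ) * Q.C ^ μ * Q.t ν (m - μ)) • (U₁ i μ * U₂ j (m - μ))) := by
        unfold W; exact Chudnovsky.wnorm_sum_le _ _ _
    _ ≤ ∑ μ ∈ Finset.range (m + 1),
        (m.choose μ : ℝ) * ((Q.H : ℝ) ^ μ * (2 * (Q.H : ℝ) ^ 2) ^ (m - μ)) * N ^ (2 * m) :=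
        Finset.sum_le_sum hterm
    _ = (∑ μ ∈ Finset.range (m + 1),
        (m.choose μ : ℝ) * ((Q.H : ℝ) ^ μ * (2 * (Q.H : ℝ) ^ 2) ^ (m - μ))) * N ^ (2 * m) := by
        rw [Finset.sum_mul]
    _ ≤ (4 * (Q.H : ℝ) ^ 3) ^ m * N ^ (2 * m) := mul_le_mul_of_nonneg_right hsum (by positivity)

variable (L : PeriodPair) in
/-- The value `W(a) = ∑_μ binom(m,μ) C^μ t_ν(m-μ) U₁(λ₁,μ)(a) U₂(λ₂,m-μ)(a)`. [folklore] -/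
theorem φx_W (ν : Fin 2) (m i j : ℕ) :
    φx L (W Q ν m i j) = ∑ μ ∈ Finset.range (m + 1), (m.choose μ : ℂ) * (Q.C : ℂ) ^ μ *
      (Q.t ν (m - μ) : ℂ) * (φx L (U₁ i μ) * φx L (U₂ j (m - μ))) := by
  unfold W
  rw [map_sum]
  refine Finset.sum_congr rfl fun μ _ => ?_
  rw [map_zsmul, map_mul, zsmul_eq_mul]
  push_cast
  ring

/-! ### The numbers `A_m(x)` -/

/-- `A_m(x) = ∑_{λ₁,λ₂ ≤ n} p(λ₁,λ₂) ∑_μ binom(m,μ) x^{m-μ} U₁(λ₁,μ)(a) U₂(λ₂,m-μ)(a)`: Masser's `A_m` is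
`A_m(α)`, and `ω₁^{-m} Φ^{(m)}(¼) = A_m(τ)`. [cite: Masser1975, §1.3 (proof of Lemma 1.8, A_m)] -/
def Aval (L : PeriodPair) (n : ℕ) (p : ℕ → ℕ → ℂ) (m : ℕ) (x : ℂ) : ℂ :=
  ∑ i ∈ Finset.range (n + 1), ∑ j ∈ Finset.range (n + 1), p i j *
    ∑ μ ∈ Finset.range (m + 1), (m.choose μ : ℂ) * x ^ (m - μ) *
      (φx L (U₁ i μ) * φx L (U₂ j (m - μ)))

/-- **`Φ^{(m)}(¼) = ω₁^m A_m(τ)`**. [cite: Masser1975, §1.3 (proof of Lemma 1.8, eq. (10))] -/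
theorem iteratedDeriv_biEval_quarter_eq_Aval (L : PeriodPair) (n : ℕ) (p : ℕ → ℕ → ℂ) (m : ℕ) :
    iteratedDeriv m (biEval L n p) (1 / 4) = L.ω₁ ^ m * Aval L n p m (L.ω₂ / L.ω₁) := by
  have hω₁ : L.ω₁ ≠ 0 := by simpa using basis_ne_zero L 0
  rw [iteratedDeriv_biEval_quarter, Aval, Finset.mul_sum]
  refine Finset.sum_congr rfl fun i _ => ?_
  rw [Finset.mul_sum]
  refine Finset.sum_congr rfl fun j _ => ?_
  rw [Finset.mul_sum, Finset.mul_sum, Finset.mul_sum]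
  refine Finset.sum_congr rfl fun μ hμ => ?_
  have hμ' : μ ≤ m := Nat.lt_succ_iff.mp (Finset.mem_range.mp hμ)
  have hpow : L.ω₁ ^ μ * L.ω₂ ^ (m - μ) = L.ω₁ ^ m * (L.ω₂ / L.ω₁) ^ (m - μ) := by
    rw [div_pow, ← mul_div_assoc, eq_div_iff (pow_ne_zero _ hω₁)]
    calc L.ω₁ ^ μ * L.ω₂ ^ (m - μ) * L.ω₁ ^ (m - μ)
        = (L.ω₁ ^ μ * L.ω₁ ^ (m - μ)) * L.ω₂ ^ (m - μ) := by ring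
      _ = L.ω₁ ^ m * L.ω₂ ^ (m - μ) := by rw [← pow_add, Nat.add_sub_cancel' hμ']
  rw [hpow]
  ring

/-- The scalar identity behind `C^m A_m(α) = E₀ + β E₁`:
`C^m ∑_μ binom(m,μ) α^{m-μ} U₁U₂ = W₀(a) + β W₁(a)`. [folklore] -/
theorem Cpow_mul_inner_eq (L : PeriodPair) (m i j : ℕ) :
    (Q.C : ℂ) ^ m * ∑ μ ∈ Finset.range (m + 1), (m.choose μ : ℂ) * Q.α ^ (m - μ) *
        (φx L (U₁ i μ) * φx L (U₂ j (m - μ))) =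
      φx L (W Q 0 m i j) + Q.β * φx L (W Q 1 m i j) := by
  rw [φx_W, φx_W, Finset.mul_sum, Finset.mul_sum, ← Finset.sum_add_distrib]
  refine Finset.sum_congr rfl fun μ hμ => ?_
  have hμ' : μ ≤ m := Nat.lt_succ_iff.mp (Finset.mem_range.mp hμ)
  have hsplit : (Q.C : ℂ) ^ m * Q.α ^ (m - μ) =
      (Q.C : ℂ) ^ μ * ((Q.t 0 (m - μ) : ℂ) + (Q.t 1 (m - μ) : ℂ) * Q.β) := by
    rw [← Q.Cpow_mul_αpow (m - μ), ← mul_assoc, ← pow_add, Nat.add_sub_cancel' hμ']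
  calc (Q.C : ℂ) ^ m * ((m.choose μ : ℂ) * Q.α ^ (m - μ) * (φx L (U₁ i μ) * φx L (U₂ j (m - μ))))
      = (m.choose μ : ℂ) * ((Q.C : ℂ) ^ m * Q.α ^ (m - μ)) * (φx L (U₁ i μ) * φx L (U₂ j (m - μ))) := by
        ring
    _ = (m.choose μ : ℂ) * ((Q.C : ℂ) ^ μ * ((Q.t 0 (m - μ) : ℂ) + (Q.t 1 (m - μ) : ℂ) * Q.β)) *
          (φx L (U₁ i μ) * φx L (U₂ j (m - μ))) := by rw [hsplit]
    _ = _ := by ring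

/-- **`C^m A_m(α) = E₀(m) + β E₁(m)`** with `E_ν(m) = ∑ p(λ₁,λ₂) (W ν m λ₁ λ₂)(a)`: the single
condition over `K₀(α)` becomes two conditions over `K₀`. [cite: Masser1975, §1.3 (proof of Lemma 1.8)] -/
theorem Cpow_mul_Aval_eq (L : PeriodPair) (n : ℕ) (p : ℕ → ℕ → ℂ) (m : ℕ) :
    (Q.C : ℂ) ^ m * Aval L n p m Q.α =
      (∑ i ∈ Finset.range (n + 1), ∑ j ∈ Finset.range (n + 1), p i j * φx L (W Q 0 m i j)) +
        Q.β * ∑ i ∈ Finset.range (n + 1), ∑ j ∈ Finset.range (n + 1), p i j * φx L (W Q 1 m i j) := by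
  unfold Aval
  rw [Finset.mul_sum, Finset.mul_sum, ← Finset.sum_add_distrib]
  refine Finset.sum_congr rfl fun i _ => ?_
  rw [Finset.mul_sum, Finset.mul_sum, ← Finset.sum_add_distrib]
  refine Finset.sum_congr rfl fun j _ => ?_
  rw [mul_left_comm, Cpow_mul_inner_eq]
  ring

/-! ### The linear system over `𝓞 K₀` and Siegel's lemma -/

namespace TSetup

variable (S : TSetup) (Q : QData)

/-- The house bound `Amat(n, k) = C₀^{2n+k} (4H³)^k (7(2n+k))^{2k}` for the cleared coefficients
`d^{2n+k} W(a)` (`λᵢ ≤ n`, `m ≤ k`). [cite: Masser1975, §1.3 (proof of Lemma 1.8, sizes H^{c₅k})] -/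
def Amat (n k : ℕ) : ℝ :=
  S.C₀ ^ (2 * n + k) * (4 * (Q.H : ℝ) ^ 3) ^ k * (7 * ((2 * n + k : ℕ) : ℝ)) ^ (2 * k)

/-- `1 ≤ Amat`. [folklore] -/
theorem one_le_Amat (n k : ℕ) : 1 ≤ S.Amat Q n k := by
  unfold Amat
  have hH : (1 : ℝ) ≤ Q.H := by exact_mod_cast Q.one_le_H
  have h4 : (1 : ℝ) ≤ 4 * (Q.H : ℝ) ^ 3 := by
    have : (1 : ℝ) ≤ (Q.H : ℝ) ^ 3 := one_le_pow₀ hH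
    linarith
  refine one_le_mul_of_one_le_of_one_le (one_le_mul_of_one_le_of_one_le
    (one_le_pow₀ S.one_le_C₀) (one_le_pow₀ h4)) ?_
  rcases Nat.eq_zero_or_pos k with rfl | hk
  · simp
  · refine one_le_pow₀ ?_
    have : (1 : ℝ) ≤ ((2 * n + k : ℕ) : ℝ) := by exact_mod_cast (by omega : 1 ≤ 2 * n + k)
    linarith

/-- **Size of the values**: every conjugate of `(W ν m i j)(genK)` is at most
`(4H³)^k (7(2n+k))^{2k} M^{2n+k}` when `i, j ≤ n`, `m ≤ k`. [cite: Masser1975, §1.3 (proof of Lemma 1.8, eq. (9))] -/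
theorem norm_embedding_aeval_W_le (σ : S.K →+* ℂ) {n k : ℕ} (ν : Fin 2) {m i j : ℕ} (hi : i ≤ n)
    (hj : j ≤ n) (hm : m ≤ k) :
    ‖σ (MvPolynomial.aeval S.G.genK (W Q ν m i j))‖ ≤
      (4 * (Q.H : ℝ) ^ 3) ^ k * (7 * ((2 * n + k : ℕ) : ℝ)) ^ (2 * k) * S.G.M ^ (2 * n + k) := by
  have hdeg : (W Q ν m i j).totalDegree ≤ 2 * n + k := (totalDegree_W_le Q ν m i j).trans (by omega)
  have h1 := S.G.norm_embedding_aeval_le σ (W Q ν m i j) hdeg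
  rw [sum_abs_coeff_eq_l1] at h1
  refine h1.trans (mul_le_mul_of_nonneg_right ?_ (pow_nonneg (zero_le_one.trans S.G.one_le_M) _))
  refine (l1_W_le Q ν m i j).trans ?_
  have hH : (1 : ℝ) ≤ Q.H := by exact_mod_cast Q.one_le_H
  have h4 : (1 : ℝ) ≤ 4 * (Q.H : ℝ) ^ 3 := by
    have : (1 : ℝ) ≤ (Q.H : ℝ) ^ 3 := one_le_pow₀ hH
    linarith
  have hb : 7 * ((i : ℝ) + j + m) ≤ 7 * ((2 * n + k : ℕ) : ℝ) := by
    push_cast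
    have : (i : ℝ) + j + m ≤ 2 * n + k := by exact_mod_cast (by omega : i + j + m ≤ 2 * n + k)
    linarith
  refine mul_le_mul (pow_le_pow_right₀ h4 hm) ?_ (by positivity) (by positivity)
  rcases Nat.eq_zero_or_pos m with rfl | hmpos
  · simp only [mul_zero, pow_zero]
    rcases Nat.eq_zero_or_pos k with rfl | hk
    · simp
    · refine one_le_pow₀ ?_
      have : (1 : ℝ) ≤ ((2 * n + k : ℕ) : ℝ) := by exact_mod_cast (by omega : 1 ≤ 2 * n + k)
      linarith
  · have hb1 : (1 : ℝ) ≤ 7 * ((2 * n + k : ℕ) : ℝ) := by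
      have : (1 : ℝ) ≤ ((2 * n + k : ℕ) : ℝ) := by exact_mod_cast (by omega : 1 ≤ 2 * n + k)
      linarith
    exact (pow_le_pow_left₀ (by positivity) hb _).trans (pow_le_pow_right₀ hb1 (by omega))

/-- **Size of the cleared values**: every conjugate of `d^{2n+k} (W ν m i j)(genK)` is at most
`Amat(n, k)`. [cite: Masser1975, §1.3 (proof of Lemma 1.8)] -/
theorem norm_embedding_den_pow_mul_aeval_W_le (σ : S.K →+* ℂ) {n k : ℕ} (ν : Fin 2) {m i j : ℕ}
    (hi : i ≤ n) (hj : j ≤ n) (hm : m ≤ k) :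
    ‖σ ((S.d : S.K) ^ (2 * n + k) * MvPolynomial.aeval S.G.genK (W Q ν m i j))‖ ≤ S.Amat Q n k := by
  rw [map_mul, map_pow, norm_mul, norm_pow, map_intCast, Complex.norm_intCast]
  have h1 := S.norm_embedding_aeval_W_le Q σ ν hi hj hm
  unfold Amat C₀
  rw [mul_pow]
  have h0 : 0 ≤ |(S.d : ℝ)| ^ (2 * n + k) := by positivity
  calc |(S.d : ℝ)| ^ (2 * n + k) * ‖σ (MvPolynomial.aeval S.G.genK (W Q ν m i j))‖
      ≤ |(S.d : ℝ)| ^ (2 * n + k) * ((4 * (Q.H : ℝ) ^ 3) ^ k * (7 * ((2 * n + k : ℕ) : ℝ)) ^ (2 * k) *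
          S.G.M ^ (2 * n + k)) := mul_le_mul_of_nonneg_left h1 h0
    _ = |(S.d : ℝ)| ^ (2 * n + k) * S.G.M ^ (2 * n + k) * (4 * (Q.H : ℝ) ^ 3) ^ k *
          (7 * ((2 * n + k : ℕ) : ℝ)) ^ (2 * k) := by ring

variable (n k : ℕ)

/-- The matrix of the `2(k+1)` conditions `E_ν(m) = 0` (rows `(ν, m)`) in the `(n+1)²` unknowns
`p(λ₁,λ₂)` (columns `(λ₁, λ₂)`), entries `d^{2n+k} (W ν m λ₁ λ₂)(genK) ∈ 𝓞 K₀`.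
[cite: Masser1975, §1.3 (proof of Lemma 1.8, the M = (k+1)f equations)] -/
def Mat : Matrix (Fin 2 × Fin (k + 1)) (Fin (n + 1) × Fin (n + 1)) (𝓞 S.K) := fun νm ij =>
  ⟨(S.d : S.K) ^ (2 * n + k) * MvPolynomial.aeval S.G.genK (W Q νm.1 νm.2 ij.1 ij.2),
    S.G.isIntegral_den_pow_mul_aeval _ ((totalDegree_W_le Q _ _ _ _).trans (by
      have := ij.1.isLt; have := ij.2.isLt; have := νm.2.isLt; omega))⟩

variable {n k}

/-- The entries of `Mat` as complex numbers. [folklore] -/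
theorem coe_Mat (νm : Fin 2 × Fin (k + 1)) (ij : Fin (n + 1) × Fin (n + 1)) :
    ((S.Mat Q n k νm ij : S.K) : ℂ) = (S.d : ℂ) ^ (2 * n + k) * φx S.L (W Q νm.1 νm.2 ij.1 ij.2) := by
  simp only [Mat, RingOfIntegers.map_mk]
  push_cast
  rw [coe_aeval_genK]

/-- The coefficient family `p` as a function `ℕ → ℕ → ℂ` (zero beyond `n`). [folklore] -/
def pFun (ξ : Fin (n + 1) × Fin (n + 1) → 𝓞 S.K) : ℕ → ℕ → ℂ := fun i j =>
  if h : i < n + 1 ∧ j < n + 1 then ((ξ (⟨i, h.1⟩, ⟨j, h.2⟩) : S.K) : ℂ) else 0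

/-- `pFun` at admissible indices. [folklore] -/
theorem pFun_apply (ξ : Fin (n + 1) × Fin (n + 1) → 𝓞 S.K) (ij : Fin (n + 1) × Fin (n + 1)) :
    S.pFun ξ ij.1 ij.2 = ((ξ ij : S.K) : ℂ) := by
  unfold pFun
  rw [dif_pos ⟨ij.1.isLt, ij.2.isLt⟩]

/-- Double sums over `range (n+1) × range (n+1)` versus sums over `Fin (n+1) × Fin (n+1)`.
[folklore] -/
theorem sum_range_range_eq_sum_fin (f : ℕ → ℕ → ℂ) :
    ∑ i ∈ Finset.range (n + 1), ∑ j ∈ Finset.range (n + 1), f i j =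
      ∑ ij : Fin (n + 1) × Fin (n + 1), f ij.1 ij.2 := by
  rw [Fintype.sum_prod_type, Finset.sum_range, Finset.sum_congr rfl fun i _ => Finset.sum_range _]
  
/-- `pFun ξ = 0` (all entries `≤ n`) iff `ξ = 0`. [folklore] -/
theorem pFun_eq_zero_iff (ξ : Fin (n + 1) × Fin (n + 1) → 𝓞 S.K) :
    (∀ i j, i ≤ n → j ≤ n → S.pFun ξ i j = 0) ↔ ξ = 0 := by
  constructor
  · intro h
    funext ij
    have := h ij.1 ij.2 (Nat.lt_succ_iff.mp ij.1.isLt) (Nat.lt_succ_iff.mp ij.2.isLt)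
    rw [pFun_apply] at this
    exact_mod_cast this
  · rintro rfl i j _ _
    unfold pFun
    split_ifs <;> simp

/-- `‖pFun ξ i j‖ ≤ P` when all `house ξ ≤ P`. [folklore] -/
theorem norm_pFun_le (ξ : Fin (n + 1) × Fin (n + 1) → 𝓞 S.K) {P : ℝ} (hP0 : 0 ≤ P)
    (hP : ∀ ij, house ((ξ ij : 𝓞 S.K) : S.K) ≤ P) (i j : ℕ) : ‖S.pFun ξ i j‖ ≤ P := by
  unfold pFun
  split_ifs with h
  · exact (NumberField.norm_embedding_le_house _ (algebraMap S.K ℂ)).trans (hP _)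
  · simpa using hP0

/-- **The system encodes `E_ν(m)`**: `(Mat ξ)(ν, m) = d^{2n+k} E_ν(m)`,
`E_ν(m) = ∑ p(λ₁,λ₂) (W ν m λ₁ λ₂)(a)`. [cite: Masser1975, §1.3 (proof of Lemma 1.8)] -/
theorem coe_mulVec (ξ : Fin (n + 1) × Fin (n + 1) → 𝓞 S.K) (νm : Fin 2 × Fin (k + 1)) :
    ((((S.Mat Q n k).mulVec ξ) νm : S.K) : ℂ) =
      (S.d : ℂ) ^ (2 * n + k) * ∑ i ∈ Finset.range (n + 1), ∑ j ∈ Finset.range (n + 1),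
        S.pFun ξ i j * φx S.L (W Q νm.1 νm.2 i j) := by
  rw [sum_range_range_eq_sum_fin, Finset.mul_sum]
  simp only [Matrix.mulVec, dotProduct, map_sum, map_mul]
  push_cast
  refine Finset.sum_congr rfl fun ij _ => ?_
  rw [S.coe_Mat Q νm ij, pFun_apply]
  ring

/-- The houses of the entries of `Mat` are bounded by `Amat(n, k)`. [folklore] -/
theorem house_Mat_le (νm : Fin 2 × Fin (k + 1)) (ij : Fin (n + 1) × Fin (n + 1)) :
    house (algebraMap (𝓞 S.K) S.K (S.Mat Q n k νm ij)) ≤ S.Amat Q n k := by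
  refine S.G.house_le_of_forall_norm_le (zero_le_one.trans (S.one_le_Amat Q n k)) fun σ => ?_
  exact S.norm_embedding_den_pow_mul_aeval_W_le Q σ νm.1 (Nat.lt_succ_iff.mp ij.1.isLt)
    (Nat.lt_succ_iff.mp ij.2.isLt) (Nat.lt_succ_iff.mp νm.2.isLt)

/-- The house bound produced by Siegel's lemma: `Pb = C_K (C_K (n+1)² Amat)`. [folklore] -/
def Pb (n k : ℕ) : ℝ := siegelConst S.K * (siegelConst S.K * (((n + 1) ^ 2 : ℕ) : ℝ) * S.Amat Q n k)

/-- `1 ≤ Pb`. [folklore] -/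
theorem one_le_Pb (n k : ℕ) : 1 ≤ S.Pb Q n k := by
  have hC := one_le_siegelConst S.K
  have hA := S.one_le_Amat Q n k
  have hq : (1 : ℝ) ≤ (((n + 1) ^ 2 : ℕ) : ℝ) := by exact_mod_cast Nat.one_le_pow _ _ (by omega)
  unfold Pb
  exact one_le_mul_of_one_le_of_one_le hC
    (one_le_mul_of_one_le_of_one_le (one_le_mul_of_one_le_of_one_le hC hq) hA)

/-- **Siegel's lemma step** (Lemma 1.8 via Lemmas 1.6–1.7; here `siegel_house` over `𝓞 K₀`): if
`(n+1)² ≥ 4(k+1)` there is a non-zero `ξ ∈ 𝓞 K₀^{(n+1)²}` with `Mat ξ = 0` and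
`house ξ(λ₁,λ₂) ≤ Pb(n, k)`. [cite: Masser1975, Lemma 1.8] -/
theorem exists_solution (hq : 4 * (k + 1) ≤ (n + 1) ^ 2) :
    ∃ ξ : Fin (n + 1) × Fin (n + 1) → 𝓞 S.K, ξ ≠ 0 ∧ (S.Mat Q n k).mulVec ξ = 0 ∧
      ∀ ij, house ((ξ ij : 𝓞 S.K) : S.K) ≤ S.Pb Q n k := by
  have hrows : Fintype.card (Fin 2 × Fin (k + 1)) = 2 * (k + 1) := by simp
  have hcols : Fintype.card (Fin (n + 1) × Fin (n + 1)) = (n + 1) ^ 2 := by simp [sq]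
  have hpos : 0 < 2 * (k + 1) := by omega
  have hlt : 2 * (k + 1) < (n + 1) ^ 2 := by omega
  haveI : Nonempty (Fin (n + 1) × Fin (n + 1)) := ⟨(0, 0)⟩
  have hA : (1 : ℝ) ≤ S.Amat Q n k := S.one_le_Amat Q n k
  obtain ⟨ξ, hξ0, hMξ, hhouse⟩ :=
    siegel_house S.K (S.Mat Q n k) hpos hlt hrows hcols hA (fun νm ij => S.house_Mat_le Q νm ij)
  refine ⟨ξ, hξ0, hMξ, fun ij => (hhouse ij).trans ?_⟩
  -- the exponent `p/(q-p) ≤ 1` and the base `≥ 1`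
  have hC := one_le_siegelConst S.K
  have hbase1 : 1 ≤ siegelConst S.K * (((n + 1) ^ 2 : ℕ) : ℝ) * S.Amat Q n k := by
    have hq1 : (1 : ℝ) ≤ (((n + 1) ^ 2 : ℕ) : ℝ) := by exact_mod_cast Nat.one_le_pow _ _ (by omega)
    exact one_le_mul_of_one_le_of_one_le (one_le_mul_of_one_le_of_one_le hC hq1) hA
  have hexp : ((2 * (k + 1) : ℕ) : ℝ) / ((((n + 1) ^ 2 : ℕ) : ℝ) - ((2 * (k + 1) : ℕ) : ℝ)) ≤ 1 := by
    have hq' : (4 : ℝ) * (k + 1) ≤ (((n + 1) ^ 2 : ℕ) : ℝ) := by exact_mod_cast hq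
    rw [div_le_one (by push_cast at hq' ⊢; linarith)]
    push_cast at hq' ⊢
    linarith
  have hpow : (siegelConst S.K * (((n + 1) ^ 2 : ℕ) : ℝ) * S.Amat Q n k) ^
      (((2 * (k + 1) : ℕ) : ℝ) / ((((n + 1) ^ 2 : ℕ) : ℝ) - ((2 * (k + 1) : ℕ) : ℝ))) ≤
      siegelConst S.K * (((n + 1) ^ 2 : ℕ) : ℝ) * S.Amat Q n k := by
    conv_rhs => rw [← Real.rpow_one (siegelConst S.K * (((n + 1) ^ 2 : ℕ) : ℝ) * S.Amat Q n k)]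
    exact Real.rpow_le_rpow_of_exponent_le hbase1 hexp
  unfold Pb
  exact mul_le_mul_of_nonneg_left hpow (zero_le_one.trans hC)

/-- **The conditions hold**: if `Mat ξ = 0` then `A_m(α) = 0` for all `m ≤ k`
(`C^m A_m(α) = E₀(m) + β E₁(m)`, `d ≠ 0`, `C ≠ 0`). [cite: Masser1975, Lemma 1.8 (A_m = 0)] -/
theorem Aval_α_eq_zero_of_mulVec {ξ : Fin (n + 1) × Fin (n + 1) → 𝓞 S.K}
    (h : (S.Mat Q n k).mulVec ξ = 0) {m : ℕ} (hm : m ≤ k) :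
    Aval S.L n (S.pFun ξ) m Q.α = 0 := by
  have hd : (S.d : ℂ) ^ (2 * n + k) ≠ 0 := pow_ne_zero _ (by exact_mod_cast S.G.den_ne_zero)
  have hC : (Q.C : ℂ) ^ m ≠ 0 := pow_ne_zero _ (by exact_mod_cast Q.hC0)
  have hE : ∀ ν : Fin 2, ∑ i ∈ Finset.range (n + 1), ∑ j ∈ Finset.range (n + 1),
      S.pFun ξ i j * φx S.L (W Q ν m i j) = 0 := by
    intro ν
    have h1 := S.coe_mulVec Q ξ (ν, ⟨m, Nat.lt_succ_of_le hm⟩)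
    rw [h] at h1
    simp only [Pi.zero_apply] at h1
    push_cast at h1
    exact (mul_eq_zero.mp h1.symm).resolve_left hd
  have h2 := Cpow_mul_Aval_eq Q S.L n (S.pFun ξ) m
  rw [hE 0, hE 1, mul_zero, add_zero] at h2
  exact (mul_eq_zero.mp h2).resolve_left hC

/-- **The numbers `E_ν(m)` as algebraic integers** (any `m ≤ K`): there is `x ∈ 𝓞 K₀` with
`x = d^{2n+K} E_ν(m) = d^{2n+K} ∑ p(λ₁,λ₂) (W ν m λ₁ λ₂)(a)` all of whose conjugates are
`≤ (n+1)² P Amat(n, K)` when `house p(λ₁,λ₂) ≤ P`. [cite: Masser1975, §1.3 (proof of Lemma 1.10, "A_m is an algebraic number … size at most H^{c₂₁k₁}")] -/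
theorem exists_E {K : ℕ} (ξ : Fin (n + 1) × Fin (n + 1) → 𝓞 S.K) {P : ℝ} (hP1 : 1 ≤ P)
    (hP : ∀ ij, house ((ξ ij : 𝓞 S.K) : S.K) ≤ P) (ν : Fin 2) {m : ℕ} (hm : m ≤ K) :
    ∃ x : 𝓞 S.K, ((x : S.K) : ℂ) = (S.d : ℂ) ^ (2 * n + K) *
      ∑ i ∈ Finset.range (n + 1), ∑ j ∈ Finset.range (n + 1), S.pFun ξ i j * φx S.L (W Q ν m i j) ∧
      ∀ σ : S.K →+* ℂ, ‖σ (x : S.K)‖ ≤ (((n + 1) ^ 2 : ℕ) : ℝ) * P * S.Amat Q n K := by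
  classical
  set c : Fin (n + 1) × Fin (n + 1) → 𝓞 S.K := fun ij =>
    ⟨(S.d : S.K) ^ (2 * n + K) * MvPolynomial.aeval S.G.genK (W Q ν m ij.1 ij.2),
      S.G.isIntegral_den_pow_mul_aeval _ ((totalDegree_W_le Q _ _ _ _).trans (by
        have := ij.1.isLt; have := ij.2.isLt; omega))⟩ with hcdef
  have hc : ∀ ij, ((c ij : S.K) : ℂ) = (S.d : ℂ) ^ (2 * n + K) * φx S.L (W Q ν m ij.1 ij.2) := by
    intro ij
    simp only [hcdef, RingOfIntegers.map_mk]
    push_cast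
    rw [coe_aeval_genK]
  refine ⟨∑ ij, ξ ij * c ij, ?_, fun σ => ?_⟩
  · rw [sum_range_range_eq_sum_fin, Finset.mul_sum]
    push_cast
    refine Finset.sum_congr rfl fun ij _ => ?_
    rw [hc ij, pFun_apply]
    ring
  · have hterm : ∀ ij : Fin (n + 1) × Fin (n + 1),
        ‖σ ((ξ ij * c ij : 𝓞 S.K) : S.K)‖ ≤ P * S.Amat Q n K := by
      intro ij
      push_cast
      rw [map_mul, norm_mul]
      refine mul_le_mul ((NumberField.norm_embedding_le_house _ σ).trans (hP ij)) ?_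
        (norm_nonneg _) (zero_le_one.trans hP1)
      simp only [hcdef, RingOfIntegers.map_mk]
      exact S.norm_embedding_den_pow_mul_aeval_W_le Q σ ν (Nat.lt_succ_iff.mp ij.1.isLt)
        (Nat.lt_succ_iff.mp ij.2.isLt) hm
    have hcard : (Finset.univ : Finset (Fin (n + 1) × Fin (n + 1))).card = (n + 1) ^ 2 := by
      simp [sq]
    calc ‖σ ((∑ ij, ξ ij * c ij : 𝓞 S.K) : S.K)‖ = ‖∑ ij, σ ((ξ ij * c ij : 𝓞 S.K) : S.K)‖ := by
          push_cast; rw [map_sum]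
      _ ≤ ∑ ij, ‖σ ((ξ ij * c ij : 𝓞 S.K) : S.K)‖ := norm_sum_le _ _
      _ ≤ ∑ _ij : Fin (n + 1) × Fin (n + 1), P * S.Amat Q n K := Finset.sum_le_sum fun ij _ => hterm ij
      _ = (((n + 1) ^ 2 : ℕ) : ℝ) * P * S.Amat Q n K := by
          rw [Finset.sum_const, hcard, nsmul_eq_mul]; push_cast; ring

/-- **Liouville for the coefficients**: a non-zero `p(λ₁,λ₂)` with `house ≤ P` (`P ≥ 1`) has
`|p(λ₁,λ₂)| ≥ P^{-(h-1)}`. [cite: Masser1975, §1.3 (end of the proof of Thm I)] -/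
theorem norm_pFun_ge (ξ : Fin (n + 1) × Fin (n + 1) → 𝓞 S.K) {P : ℝ} (hP1 : 1 ≤ P)
    (hP : ∀ ij, house ((ξ ij : 𝓞 S.K) : S.K) ≤ P) (ij : Fin (n + 1) × Fin (n + 1)) (hξ : ξ ij ≠ 0) :
    (P ^ (S.G.h - 1))⁻¹ ≤ ‖S.pFun ξ ij.1 ij.2‖ := by
  rw [pFun_apply]
  exact S.G.norm_ge_of_forall_norm_le hξ hP1 fun σ =>
    (NumberField.norm_embedding_le_house _ σ).trans (hP ij)

/-! ### Liouville's inequality in `K₀` for numbers `x + β y` -/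

/-- **Liouville for `x + βy`** (`x, y ∈ 𝓞 K₀` with all conjugates `≤ Bx` resp. `≤ By`,
`Bx, By ≥ 1`, discriminant `≠ 0`): if `x + βy ≠ 0` then
`|x + βy| ≥ ((3H² Bx² By²)^{h-1} · 4 H Bx By)⁻¹` — through the norm
`(x + βy)(x + β'y) = x² - Bxy + ACy² ∈ 𝓞 K₀`. [cite: Masser1975, §1.3 (proof of Lemma 1.10, "|A_m| > H^{-c₂₂ k₁}")] -/
theorem quad_liouville (hdisc : Q.B ^ 2 - 4 * Q.A * Q.C ≠ 0) {x y : 𝓞 S.K} {Bx By : ℝ}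
    (hBx : 1 ≤ Bx) (hBy : 1 ≤ By) (hx : ∀ σ : S.K →+* ℂ, ‖σ (x : S.K)‖ ≤ Bx)
    (hy : ∀ σ : S.K →+* ℂ, ‖σ (y : S.K)‖ ≤ By)
    (hZ : ((x : S.K) : ℂ) + Q.β * ((y : S.K) : ℂ) ≠ 0) :
    ((3 * (Q.H : ℝ) ^ 2 * Bx ^ 2 * By ^ 2) ^ (S.G.h - 1) * (4 * Q.H * Bx * By))⁻¹ ≤
      ‖((x : S.K) : ℂ) + Q.β * ((y : S.K) : ℂ)‖ := by
  have hH : (1 : ℝ) ≤ Q.H := by exact_mod_cast Q.one_le_H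
  set xc : ℂ := ((x : S.K) : ℂ) with hxc
  set yc : ℂ := ((y : S.K) : ℂ) with hyc
  set β' : ℂ := -(Q.B : ℂ) - Q.β with hβ'
  have hxle : ‖xc‖ ≤ Bx := by simpa using hx (algebraMap S.K ℂ)
  have hyle : ‖yc‖ ≤ By := by simpa using hy (algebraMap S.K ℂ)
  -- the norm element
  set N : 𝓞 S.K := x * x - Q.B • (x * y) + (Q.A * Q.C) • (y * y) with hN
  have hNc : ((N : S.K) : ℂ) = (xc + Q.β * yc) * (xc + β' * yc) := by
    simp only [hN, hβ']
    push_cast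
    simp only [zsmul_eq_mul]
    push_cast
    have hβ2 : Q.β ^ 2 = -(Q.B : ℂ) * Q.β - Q.A * Q.C := by linear_combination Q.hβ
    linear_combination (yc ^ 2) * hβ2
  set BN : ℝ := 3 * (Q.H : ℝ) ^ 2 * Bx ^ 2 * By ^ 2 with hBN
  have hH2 : (1 : ℝ) ≤ (Q.H : ℝ) ^ 2 := one_le_pow₀ hH
  have hBx2 : (1 : ℝ) ≤ Bx ^ 2 := one_le_pow₀ hBx
  have hBy2 : (1 : ℝ) ≤ By ^ 2 := one_le_pow₀ hBy
  have hBxy : (1 : ℝ) ≤ Bx * By := one_le_mul_of_one_le_of_one_le hBx hBy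
  have hBxy2 : (1 : ℝ) ≤ Bx ^ 2 * By ^ 2 := one_le_mul_of_one_le_of_one_le hBx2 hBy2
  have hHB : (1 : ℝ) ≤ (Q.H : ℝ) ^ 2 * (Bx ^ 2 * By ^ 2) := one_le_mul_of_one_le_of_one_le hH2 hBxy2
  have hBN1 : 1 ≤ BN := by rw [hBN]; nlinarith
  have hconjN : ∀ σ : S.K →+* ℂ, ‖σ (N : S.K)‖ ≤ BN := by
    intro σ
    have hA : |(Q.A : ℝ)| ≤ Q.H := by exact_mod_cast Q.hA
    have hB : |(Q.B : ℝ)| ≤ Q.H := by exact_mod_cast Q.hB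
    have hC : |(Q.C : ℝ)| ≤ Q.H := by exact_mod_cast Q.hC
    have hsx := hx σ
    have hsy := hy σ
    simp only [hN]
    push_cast
    simp only [zsmul_eq_mul, map_add, map_sub, map_mul, map_intCast, Int.cast_mul]
    have hre : σ (x : S.K) * σ (x : S.K) - (Q.B : ℂ) * (σ (x : S.K) * σ (y : S.K)) +
        (Q.A : ℂ) * (Q.C : ℂ) * (σ (y : S.K) * σ (y : S.K)) =
        σ (x : S.K) * σ (x : S.K) + (-(Q.B : ℂ)) * (σ (x : S.K) * σ (y : S.K)) +
          (Q.A : ℂ) * (Q.C : ℂ) * (σ (y : S.K) * σ (y : S.K)) := by ring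
    rw [hre]
    have hx0 : 0 ≤ ‖σ (x : S.K)‖ := norm_nonneg _
    have hy0 : 0 ≤ ‖σ (y : S.K)‖ := norm_nonneg _
    calc ‖σ (x : S.K) * σ (x : S.K) + (-(Q.B : ℂ)) * (σ (x : S.K) * σ (y : S.K)) +
          (Q.A : ℂ) * (Q.C : ℂ) * (σ (y : S.K) * σ (y : S.K))‖
        ≤ ‖σ (x : S.K) * σ (x : S.K)‖ + ‖(-(Q.B : ℂ)) * (σ (x : S.K) * σ (y : S.K))‖ +
            ‖(Q.A : ℂ) * (Q.C : ℂ) * (σ (y : S.K) * σ (y : S.K))‖ := norm_add₃_le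
      _ ≤ Bx * Bx + Q.H * (Bx * By) + Q.H * Q.H * (By * By) := by
          simp only [norm_mul, norm_neg, Complex.norm_intCast]
          gcongr
      _ ≤ BN := by
          rw [hBN]
          have h1 : Bx * Bx ≤ (Q.H : ℝ) ^ 2 * Bx ^ 2 * By ^ 2 := by
            have := one_le_mul_of_one_le_of_one_le hH2 hBy2
            nlinarith
          have h2 : (Q.H : ℝ) * (Bx * By) ≤ (Q.H : ℝ) ^ 2 * Bx ^ 2 * By ^ 2 := by
            have := one_le_mul_of_one_le_of_one_le hH hBxy
            have h0 : 0 ≤ (Q.H : ℝ) * (Bx * By) := by positivity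
            nlinarith
          have h3 : (Q.H : ℝ) * Q.H * (By * By) ≤ (Q.H : ℝ) ^ 2 * Bx ^ 2 * By ^ 2 := by
            have h0 : 0 ≤ (Q.H : ℝ) * Q.H * (By * By) := by positivity
            nlinarith
          linarith
  -- the denominators
  have hden : ‖xc + β' * yc‖ ≤ 4 * Q.H * Bx * By := by
    calc ‖xc + β' * yc‖ ≤ ‖xc‖ + ‖β'‖ * ‖yc‖ := by rw [← norm_mul]; exact norm_add_le _ _
      _ ≤ Bx + 3 * Q.H * By := by
          have hβ'le : ‖β'‖ ≤ 3 * Q.H := Q.norm_β'_le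
          have hy0 : 0 ≤ ‖yc‖ := norm_nonneg _
          gcongr
      _ ≤ 4 * Q.H * Bx * By := by
          have h1 : Bx ≤ Q.H * Bx * By := by
            have := one_le_mul_of_one_le_of_one_le hH hBy
            nlinarith
          have h2 : 3 * (Q.H : ℝ) * By ≤ 3 * Q.H * Bx * By := by
            have h0 : 0 ≤ 3 * (Q.H : ℝ) * By := by positivity
            nlinarith
          linarith
  have hden0 : 0 < 4 * (Q.H : ℝ) * Bx * By := by positivity
  have hBNpow : 0 < BN ^ (S.G.h - 1) := by positivity
  by_cases hcase : xc + β' * yc = 0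
  · -- then `x + βy = (β - β') y`, `y ≠ 0`
    have hZ' : xc + Q.β * yc = (Q.β - β') * yc := by linear_combination hcase
    have hy0 : y ≠ 0 := by
      intro h0
      apply hZ
      rw [hZ', show yc = 0 by simp [hyc, h0], mul_zero]
    have hLy := S.G.norm_ge_of_forall_norm_le hy0 hBy hy
    rw [hZ', norm_mul]
    have h1 := Q.one_le_norm_β_sub_β' hdisc
    calc ((3 * (Q.H : ℝ) ^ 2 * Bx ^ 2 * By ^ 2) ^ (S.G.h - 1) * (4 * Q.H * Bx * By))⁻¹
        ≤ (By ^ (S.G.h - 1))⁻¹ := by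
          apply inv_anti₀ (by positivity)
          calc By ^ (S.G.h - 1) ≤ BN ^ (S.G.h - 1) := by
                apply pow_le_pow_left₀ (zero_le_one.trans hBy)
                rw [hBN]
                have h0 : By ≤ By ^ 2 := by nlinarith
                have := one_le_mul_of_one_le_of_one_le hH2 hBx2
                nlinarith
            _ = BN ^ (S.G.h - 1) * 1 := (mul_one _).symm
            _ ≤ BN ^ (S.G.h - 1) * (4 * Q.H * Bx * By) := by
                apply mul_le_mul_of_nonneg_left _ hBNpow.le
                have := one_le_mul_of_one_le_of_one_le hH hBxy
                nlinarith
      _ ≤ ‖yc‖ := hLy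
      _ = 1 * ‖yc‖ := (one_mul _).symm
      _ ≤ ‖Q.β - β'‖ * ‖yc‖ := mul_le_mul_of_nonneg_right h1 (norm_nonneg _)
  · -- then `N ≠ 0` and `|x + βy| = |N| / |x + β'y|`
    have hN0 : N ≠ 0 := by
      intro h0
      have : ((N : S.K) : ℂ) = 0 := by rw [h0]; rfl
      rw [hNc] at this
      rcases mul_eq_zero.mp this with h | h
      · exact hZ h
      · exact hcase h
    have hLN := S.G.norm_ge_of_forall_norm_le hN0 hBN1 hconjN
    rw [hNc, norm_mul] at hLN
    have hpos : 0 < ‖xc + β' * yc‖ := norm_pos_iff.mpr hcase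
    rw [mul_inv, ← div_eq_mul_inv]
    rw [div_le_iff₀ hden0]
    calc (BN ^ (S.G.h - 1))⁻¹ ≤ ‖xc + Q.β * yc‖ * ‖xc + β' * yc‖ := hLN
      _ ≤ ‖xc + Q.β * yc‖ * (4 * Q.H * Bx * By) := mul_le_mul_of_nonneg_left hden (norm_nonneg _)

end TSetup

/-! ### The comparison `A_m(τ) - A_m(α)` (eq. (10)) -/

/-- `|x^r - y^r| ≤ r T^r |x - y|` for `|x|, |y| ≤ T`, `T ≥ 1`. [folklore] -/
theorem norm_pow_sub_pow_le {x y : ℂ} {T : ℝ} (hT : 1 ≤ T) (hx : ‖x‖ ≤ T) (hy : ‖y‖ ≤ T) (r : ℕ) :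
    ‖x ^ r - y ^ r‖ ≤ r * T ^ r * ‖x - y‖ := by
  have h := (Commute.all x y).geom_sum₂_mul r
  rw [← h, norm_mul]
  refine mul_le_mul_of_nonneg_right ?_ (norm_nonneg _)
  calc ‖∑ i ∈ Finset.range r, x ^ i * y ^ (r - 1 - i)‖ ≤ ∑ i ∈ Finset.range r, ‖x ^ i * y ^ (r - 1 - i)‖ :=
        norm_sum_le _ _
    _ ≤ ∑ _i ∈ Finset.range r, T ^ r := by
        refine Finset.sum_le_sum fun i hi => ?_
        have hi' : i < r := Finset.mem_range.mp hi
        rw [norm_mul, norm_pow, norm_pow]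
        calc ‖x‖ ^ i * ‖y‖ ^ (r - 1 - i) ≤ T ^ i * T ^ (r - 1 - i) := by gcongr
          _ = T ^ (i + (r - 1 - i)) := (pow_add _ _ _).symm
          _ ≤ T ^ r := pow_le_pow_right₀ hT (by omega)
    _ = r * T ^ r := by rw [Finset.sum_const, Finset.card_range, nsmul_eq_mul]

/-- `|U₁(λ₁,μ)(a)| ≤ (7(λ₁+μ))^μ M^{λ₁+μ}` and the same for `U₂`. [folklore] -/
theorem norm_φx_U₁_le (S : TSetup) (i a : ℕ) :
    ‖φx S.L (U₁ i a)‖ ≤ (7 * ((i : ℝ) + a)) ^ a * S.G.M ^ (i + a) := by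
  have h := norm_aeval_le_l1 (U₁ i a) (xv S.L) S.G.one_le_M S.norm_xv_le
  refine h.trans ?_
  exact mul_le_mul (l1_U₁_le i a) (pow_le_pow_right₀ S.G.one_le_M (totalDegree_U₁_le i a))
    (pow_nonneg (zero_le_one.trans S.G.one_le_M) _) (by positivity)

/-- `|U₂(λ₂,c)(a)| ≤ (7(λ₂+c))^c M^{λ₂+c}`. [folklore] -/
theorem norm_φx_U₂_le (S : TSetup) (j c : ℕ) :
    ‖φx S.L (U₂ j c)‖ ≤ (7 * ((j : ℝ) + c)) ^ c * S.G.M ^ (j + c) := by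
  have h := norm_aeval_le_l1 (U₂ j c) (xv S.L) S.G.one_le_M S.norm_xv_le
  refine h.trans ?_
  exact mul_le_mul (l1_U₂_le j c) (pow_le_pow_right₀ S.G.one_le_M (totalDegree_U₂_le j c))
    (pow_nonneg (zero_le_one.trans S.G.one_le_M) _) (by positivity)

/-- The factor `D(n, m) = (m+1) 2^m m T^m (7(2n+m+1))^{2m} M^{2(n+m)}` of the comparison (10).
[cite: Masser1975, §1.3 (proof of Lemma 1.8, eq. (10))] -/
def Dcomp (S : TSetup) (T : ℝ) (n m : ℕ) : ℝ :=
  ((m : ℝ) + 1) * 2 ^ m * m * T ^ m * (7 * ((2 * n + m + 1 : ℕ) : ℝ)) ^ (2 * m) * S.G.M ^ (2 * (n + m))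

/-- `0 ≤ Dcomp`. [folklore] -/
theorem Dcomp_nonneg (S : TSetup) {T : ℝ} (hT : 0 ≤ T) (n m : ℕ) : 0 ≤ Dcomp S T n m := by
  unfold Dcomp
  have hM0 : 0 ≤ S.G.M := zero_le_one.trans S.G.one_le_M
  refine mul_nonneg (mul_nonneg (mul_nonneg (mul_nonneg (mul_nonneg (by positivity)
    (by positivity)) (Nat.cast_nonneg m)) (pow_nonneg hT m)) (by positivity)) (pow_nonneg hM0 _)

/-- **Comparison (10)**: `|A_m(x) - A_m(y)| ≤ (∑|p|) · D(n,m) · |x - y|` for `|x|, |y| ≤ T`,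
`T ≥ 1` (in the book `x = τ`, `y = α`: "`|ω₁^{-m}Φ_m(¼) - A_m| < exp(-k^{3/2+16δ})`").
[cite: Masser1975, §1.3 (proof of Lemma 1.8, eq. (10))] -/
theorem norm_Aval_sub_le (S : TSetup) (n m : ℕ) (p : ℕ → ℕ → ℂ) {x y : ℂ} {T : ℝ} (hT : 1 ≤ T)
    (hx : ‖x‖ ≤ T) (hy : ‖y‖ ≤ T) :
    ‖Aval S.L n p m x - Aval S.L n p m y‖ ≤ coeffSum n p * Dcomp S T n m * ‖x - y‖ := by
  have hM := S.G.one_le_M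
  have hM0 : 0 ≤ S.G.M := zero_le_one.trans hM
  set N : ℝ := 7 * ((2 * n + m + 1 : ℕ) : ℝ) with hN
  have hN1 : 1 ≤ N := by
    rw [hN]
    have : (1 : ℝ) ≤ ((2 * n + m + 1 : ℕ) : ℝ) := by exact_mod_cast (by omega : 1 ≤ 2 * n + m + 1)
    linarith
  have hN0 : 0 ≤ N := zero_le_one.trans hN1
  have hT0 : 0 ≤ T := zero_le_one.trans hT
  have hNM0 : 0 ≤ N ^ m * S.G.M ^ (n + m) := mul_nonneg (pow_nonneg hN0 _) (pow_nonneg hM0 _)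
  -- bounds for the values `U₁(a), U₂(a)`
  have hU1 : ∀ {i μ : ℕ}, i ≤ n → μ ≤ m → ‖φx S.L (U₁ i μ)‖ ≤ N ^ m * S.G.M ^ (n + m) := by
    intro i μ hi hμ
    refine (norm_φx_U₁_le S i μ).trans ?_
    have hb : 7 * ((i : ℝ) + μ) ≤ N := by
      rw [hN]; push_cast
      have : (i : ℝ) + μ ≤ 2 * n + m + 1 := by exact_mod_cast (by omega : i + μ ≤ 2 * n + m + 1)
      linarith
    exact mul_le_mul ((pow_le_pow_left₀ (by positivity) hb μ).trans (pow_le_pow_right₀ hN1 hμ))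
      (pow_le_pow_right₀ hM (by omega)) (pow_nonneg hM0 _) (pow_nonneg hN0 _)
  have hU2 : ∀ {j c : ℕ}, j ≤ n → c ≤ m → ‖φx S.L (U₂ j c)‖ ≤ N ^ m * S.G.M ^ (n + m) := by
    intro j c hj hc
    refine (norm_φx_U₂_le S j c).trans ?_
    have hb : 7 * ((j : ℝ) + c) ≤ N := by
      rw [hN]; push_cast
      have : (j : ℝ) + c ≤ 2 * n + m + 1 := by exact_mod_cast (by omega : j + c ≤ 2 * n + m + 1)
      linarith
    exact mul_le_mul ((pow_le_pow_left₀ (by positivity) hb c).trans (pow_le_pow_right₀ hN1 hc))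
      (pow_le_pow_right₀ hM (by omega)) (pow_nonneg hM0 _) (pow_nonneg hN0 _)
  -- termwise bound
  have hterm : ∀ {i j : ℕ}, i ≤ n → j ≤ n → ∀ μ ∈ Finset.range (m + 1),
      ‖(m.choose μ : ℂ) * x ^ (m - μ) * (φx S.L (U₁ i μ) * φx S.L (U₂ j (m - μ))) -
        (m.choose μ : ℂ) * y ^ (m - μ) * (φx S.L (U₁ i μ) * φx S.L (U₂ j (m - μ)))‖ ≤
        2 ^ m * (m * T ^ m * ‖x - y‖) * (N ^ m * S.G.M ^ (n + m)) ^ 2 := by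
    intro i j hi hj μ hμ
    have hμ' : μ ≤ m := Nat.lt_succ_iff.mp (Finset.mem_range.mp hμ)
    have hfac : (m.choose μ : ℂ) * x ^ (m - μ) * (φx S.L (U₁ i μ) * φx S.L (U₂ j (m - μ))) -
        (m.choose μ : ℂ) * y ^ (m - μ) * (φx S.L (U₁ i μ) * φx S.L (U₂ j (m - μ))) =
        (m.choose μ : ℂ) * (x ^ (m - μ) - y ^ (m - μ)) *
          (φx S.L (U₁ i μ) * φx S.L (U₂ j (m - μ))) := by ring
    rw [hfac, norm_mul, norm_mul, Complex.norm_natCast]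
    have hchoose : (m.choose μ : ℝ) ≤ 2 ^ m := by exact_mod_cast Nat.choose_le_two_pow m μ
    have hpow : ‖x ^ (m - μ) - y ^ (m - μ)‖ ≤ m * T ^ m * ‖x - y‖ := by
      refine (norm_pow_sub_pow_le hT hx hy (m - μ)).trans ?_
      have h1 : ((m - μ : ℕ) : ℝ) ≤ m := by exact_mod_cast Nat.sub_le m μ
      have h2 : T ^ (m - μ) ≤ T ^ m := pow_le_pow_right₀ hT (Nat.sub_le m μ)
      have h3 : 0 ≤ ‖x - y‖ := norm_nonneg _
      exact mul_le_mul (mul_le_mul h1 h2 (pow_nonneg hT0 _) (Nat.cast_nonneg m)) le_rfl h3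
        (mul_nonneg (Nat.cast_nonneg m) (pow_nonneg hT0 m))
    have hUU : ‖φx S.L (U₁ i μ) * φx S.L (U₂ j (m - μ))‖ ≤ (N ^ m * S.G.M ^ (n + m)) ^ 2 := by
      rw [norm_mul, sq]
      exact mul_le_mul (hU1 hi hμ') (hU2 hj (Nat.sub_le m μ)) (norm_nonneg _) hNM0
    have h0a : 0 ≤ ‖x ^ (m - μ) - y ^ (m - μ)‖ := norm_nonneg _
    have h0b : 0 ≤ ‖φx S.L (U₁ i μ) * φx S.L (U₂ j (m - μ))‖ := norm_nonneg _
    have hmT : 0 ≤ (m : ℝ) * T ^ m * ‖x - y‖ :=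
      mul_nonneg (mul_nonneg (Nat.cast_nonneg m) (pow_nonneg hT0 m)) (norm_nonneg _)
    exact mul_le_mul (mul_le_mul hchoose hpow h0a (by positivity)) hUU h0b
      (mul_nonneg (by positivity) hmT)
  -- the inner difference
  have hinner : ∀ {i j : ℕ}, i ≤ n → j ≤ n →
      ‖(∑ μ ∈ Finset.range (m + 1), (m.choose μ : ℂ) * x ^ (m - μ) *
          (φx S.L (U₁ i μ) * φx S.L (U₂ j (m - μ)))) -
        ∑ μ ∈ Finset.range (m + 1), (m.choose μ : ℂ) * y ^ (m - μ) *
          (φx S.L (U₁ i μ) * φx S.L (U₂ j (m - μ)))‖ ≤ Dcomp S T n m * ‖x - y‖ := by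
    intro i j hi hj
    rw [← Finset.sum_sub_distrib]
    refine (norm_sum_le _ _).trans ((Finset.sum_le_sum (hterm hi hj)).trans (le_of_eq ?_))
    rw [Finset.sum_const, Finset.card_range, nsmul_eq_mul, Dcomp, hN]
    push_cast
    ring
  -- assemble
  unfold Aval
  rw [← Finset.sum_sub_distrib]
  refine (norm_sum_le _ _).trans ?_
  have hrow : ∀ i ∈ Finset.range (n + 1),
      ‖(∑ j ∈ Finset.range (n + 1), p i j * ∑ μ ∈ Finset.range (m + 1), (m.choose μ : ℂ) *
          x ^ (m - μ) * (φx S.L (U₁ i μ) * φx S.L (U₂ j (m - μ)))) -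
        ∑ j ∈ Finset.range (n + 1), p i j * ∑ μ ∈ Finset.range (m + 1), (m.choose μ : ℂ) *
          y ^ (m - μ) * (φx S.L (U₁ i μ) * φx S.L (U₂ j (m - μ)))‖ ≤
        ∑ j ∈ Finset.range (n + 1), ‖p i j‖ * (Dcomp S T n m * ‖x - y‖) := by
    intro i hi
    have hi' : i ≤ n := Nat.lt_succ_iff.mp (Finset.mem_range.mp hi)
    rw [← Finset.sum_sub_distrib]
    refine (norm_sum_le _ _).trans (Finset.sum_le_sum fun j hj => ?_)
    have hj' : j ≤ n := Nat.lt_succ_iff.mp (Finset.mem_range.mp hj)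
    rw [← mul_sub, norm_mul]
    exact mul_le_mul_of_nonneg_left (hinner hi' hj') (norm_nonneg _)
  refine (Finset.sum_le_sum hrow).trans (le_of_eq ?_)
  rw [coeffSum, Finset.sum_mul, Finset.sum_mul]
  refine Finset.sum_congr rfl fun i _ => ?_
  rw [Finset.sum_mul, Finset.sum_mul]
  exact Finset.sum_congr rfl fun j _ => by ring

end Literature.NumberTheory.Transcendental.Masser1975
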